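import Mathlib.Probability.Moments.SubGaussian
import Mathlib.Analysis.SpecialFunctions.Log.Deriv
import Mathlib.Analysis.SpecialFunctions.Trigonometric.Series
import Mathlib.Analysis.SpecialFunctions.Trigonometric.DerivHyp
import Mathlib.Analysis.SpecialFunctions.Pow.Real
import Mathlib.Analysis.Convex.SpecificFunctions.Basic
import Mathlib.MeasureTheory.Function.L1Space.Integrable
import Literature.ComputerArithmetic.ConnollyHighamMary2021.ProbabilisticBounds
import HarnessLib

/-!
# Proof of CHM21 Theorem 4.6 (probabilistic product bound) from the SR error model

Source statement: [ConnollyHighamMary2021] Theorem 4.6 — for mean-independent, mean-zero errors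
`|δᵢ| ≤ u < 1` and exponents `ρᵢ = ±1`, `∏_{i<n}(1 + δᵢ)^{ρᵢ} = 1 + θₙ` with `|θₙ| ≤ γ̃ₙ(λ)
= exp(λ√n u + n u²/(1 − u)) − 1` with probability at least `1 − 2 exp(−λ²/2)` (the proof in the paper,
following Higham–Mary, is: `log(1 + δᵢ) = δᵢ + rᵢ`, `|rᵢ| ≤ u²/(1 − u)`; Azuma–Hoeffding for the
martingale `∑ ρᵢ δᵢ` with increments bounded by `u`).

This file DISCHARGES the named fact `productBoundCHM` of `ProbabilisticBounds`: it is proved here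
from `SRErrorModel μ u δ` on an arbitrary probability space. The Azuma–Hoeffding step is carried out
elementarily (no conditional expectations are needed): by the chord inequality
`e^{tx} ≤ cosh(tu) + x·sinh(tu)/u` (`|x| ≤ u`) and mean independence applied to the bounded measurable
functional `exp(t ∑_{i<m} ρᵢδᵢ)` of the earlier errors, `E exp(t ∑_{i<m+1} ρᵢδᵢ) ≤ cosh(tu)·E exp(t
∑_{i<m} ρᵢδᵢ)`, and `cosh(tu) ≤ exp(t²u²/2)`; hence `∑_{i<n} ρᵢδᵢ` has sub-Gaussian mgf with
parameter `n u²` and Mathlib's Chernoff bound (`HasSubgaussianMGF.measure_ge_le`) gives both tails.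
-/

namespace Literature.ComputerArithmetic.ConnollyHighamMary2021

open MeasureTheory ProbabilityTheory Finset Real
open scoped NNReal

variable {Ω : Type*} [MeasurableSpace Ω] {μ : Measure Ω} {u : ℝ} {δ : ℕ → Ω → ℝ}

/-! ### Private analytic plumbing -/

/-- [folklore] chord inequality for the convex exponential on `[−u, u]`. -/
private theorem exp_mul_le_cosh_add {u x : ℝ} (hu : 0 < u) (hx : |x| ≤ u) (t : ℝ) :
    exp (t * x) ≤ cosh (t * u) + sinh (t * u) / u * x := by
  have hab := abs_le.mp hx
  have hu0 : u ≠ 0 := hu.ne'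
  have ha : 0 ≤ (u - x) / (2 * u) := div_nonneg (by linarith) (by linarith)
  have hb : 0 ≤ (u + x) / (2 * u) := div_nonneg (by linarith) (by linarith)
  have hab1 : (u - x) / (2 * u) + (u + x) / (2 * u) = 1 := by
    field_simp; ring
  have key := convexOn_exp.2 (Set.mem_univ (-(t * u))) (Set.mem_univ (t * u)) ha hb hab1
  simp only [smul_eq_mul] at key
  have h1 : (u - x) / (2 * u) * (-(t * u)) + (u + x) / (2 * u) * (t * u) = t * x := by
    field_simp; ring
  rw [h1] at key
  rw [Real.cosh_eq, Real.sinh_eq]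
  calc exp (t * x) ≤ (u - x) / (2 * u) * exp (-(t * u)) + (u + x) / (2 * u) * exp (t * u) := key
    _ = (exp (t * u) + exp (-(t * u))) / 2 + (exp (t * u) - exp (-(t * u))) / 2 / u * x := by
      field_simp; ring

/-- [folklore] `|log(1 + d) − d| ≤ u²/(1 − u)` for `|d| ≤ u < 1` (Taylor remainder of `log`). -/
private theorem abs_log_one_add_sub_le {d u : ℝ} (hd : |d| ≤ u) (hu1 : u < 1) :
    |log (1 + d) - d| ≤ u ^ 2 / (1 - u) := by
  have hd1 : |(-d)| < 1 := by rw [abs_neg]; exact lt_of_le_of_lt hd hu1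
  have h := abs_log_sub_add_sum_range_le hd1 1
  have h2 : (∑ i ∈ range 1, (-d) ^ (i + 1) / ((i : ℝ) + 1)) + log (1 - -d) = log (1 + d) - d := by
    rw [Finset.sum_range_one]; norm_num; ring
  rw [h2, abs_neg] at h
  refine h.trans ?_
  have hda : 0 ≤ |d| := abs_nonneg d
  have : |d| ^ (1 + 1) = |d| ^ 2 := by norm_num
  rw [this]
  exact div_le_div₀ (sq_nonneg u) (pow_le_pow_left₀ hda hd 2) (by linarith) (by linarith)

/-- [folklore] `|e^L − 1| ≤ e^{|L|} − 1`. -/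
private theorem abs_exp_sub_one_le_exp_abs (L : ℝ) : |exp L - 1| ≤ exp |L| - 1 := by
  rcases le_total 0 L with hL | hL
  · rw [abs_of_nonneg hL, abs_of_nonneg (by linarith [Real.one_le_exp_iff.mpr hL])]
  · have h1 : exp L ≤ 1 := Real.exp_le_one_iff.mpr hL
    rw [abs_of_nonpos hL, abs_of_nonpos (by linarith)]
    have := Real.one_le_cosh L
    rw [Real.cosh_eq] at this
    linarith

/-- [folklore] integer powers of a positive real through `exp ∘ log`. -/
private theorem zpow_eq_exp_log {a : ℝ} (ha : 0 < a) (ρ : ℤ) : a ^ ρ = exp (ρ * log a) := by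
  rw [← Real.rpow_intCast, Real.rpow_def_of_pos ha, mul_comm]

/-- [folklore] the deterministic (linearisation) half of CHM21 Thm 4.6: if `|∑ ρᵢδᵢ| < λ√n·u` then
`|∏(1 + δᵢ)^{ρᵢ} − 1| < γ̃ₙ(λ)`. -/
private theorem prod_sub_one_lt_gammaTilde {n : ℕ} {u lam : ℝ} (hu1 : u < 1) {d : ℕ → ℝ}
    (hd : ∀ i, |d i| ≤ u) {ρ : ℕ → ℤ} (hρ : ∀ i, ρ i = 1 ∨ ρ i = -1)
    (hS : |∑ i ∈ range n, (ρ i : ℝ) * d i| < lam * Real.sqrt n * u) :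
    |(∏ i ∈ range n, (1 + d i) ^ (ρ i)) - 1| < gammaTilde n u lam := by
  have hpos : ∀ i, 0 < 1 + d i := fun i => by
    have := (abs_le.mp (hd i)).1; linarith
  have habsρ : ∀ i, |(ρ i : ℝ)| = 1 := fun i => by
    rcases hρ i with h | h <;> simp [h]
  set L := ∑ i ∈ range n, (ρ i : ℝ) * log (1 + d i) with hL
  have hprod : (∏ i ∈ range n, (1 + d i) ^ (ρ i)) = exp L := by
    rw [hL, Real.exp_sum]
    exact prod_congr rfl (fun i _ => zpow_eq_exp_log (hpos i) (ρ i))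
  have hLS : |L - ∑ i ∈ range n, (ρ i : ℝ) * d i| ≤ n * (u ^ 2 / (1 - u)) := by
    rw [hL, ← Finset.sum_sub_distrib]
    refine (abs_sum_le_sum_abs _ _).trans ?_
    calc ∑ i ∈ range n, |(ρ i : ℝ) * log (1 + d i) - (ρ i : ℝ) * d i|
        ≤ ∑ _i ∈ range n, u ^ 2 / (1 - u) := by
          refine sum_le_sum (fun i _ => ?_)
          rw [← mul_sub, abs_mul, habsρ i, one_mul]
          exact abs_log_one_add_sub_le (hd i) hu1
      _ = n * (u ^ 2 / (1 - u)) := by rw [sum_const, card_range, nsmul_eq_mul]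
  have hLabs : |L| < lam * Real.sqrt n * u + n * u ^ 2 / (1 - u) := by
    have := abs_sub_abs_le_abs_sub L (∑ i ∈ range n, (ρ i : ℝ) * d i)
    rw [mul_div_assoc]
    linarith
  unfold gammaTilde
  rw [hprod]
  calc |exp L - 1| ≤ exp |L| - 1 := abs_exp_sub_one_le_exp_abs L
    _ < exp (lam * Real.sqrt n * u + n * u ^ 2 / (1 - u)) - 1 :=
        sub_lt_sub_right (Real.exp_lt_exp.mpr hLabs) 1

/-! ### Private probabilistic plumbing -/

/-- [folklore] clipping to `[−u, u]`. -/
private def clip (u t : ℝ) : ℝ := max (-u) (min t u)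

/-- [folklore] -/
private theorem abs_clip_le {u : ℝ} (hu : 0 ≤ u) (t : ℝ) : |clip u t| ≤ u := by
  unfold clip
  rw [abs_le]
  exact ⟨le_max_left _ _, max_le (by linarith) (min_le_right _ _)⟩

/-- [folklore] -/
private theorem clip_eq_self {u t : ℝ} (h : |t| ≤ u) : clip u t = t := by
  rw [abs_le] at h
  unfold clip
  rw [min_eq_left h.2, max_eq_right h.1]

/-- [folklore] -/
private theorem measurable_clip (u : ℝ) : Measurable (clip u) :=
  measurable_const.max (measurable_id.min measurable_const)

/-- [folklore] `|ρᵢ δᵢ| ≤ u`. -/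
private theorem abs_rho_mul_le (h : SRErrorModel μ u δ) {ρ : ℕ → ℤ} (hρ : ∀ i, ρ i = 1 ∨ ρ i = -1)
    (i : ℕ) (ω : Ω) : |(ρ i : ℝ) * δ i ω| ≤ u := by
  have habsρ : |(ρ i : ℝ)| = 1 := by rcases hρ i with h | h <;> simp [h]
  rw [abs_mul, habsρ, one_mul]; exact h.bounded i ω

/-- [folklore] `0 ≤ u` as soon as the space is nonempty. -/
private theorem u_nonneg (h : SRErrorModel μ u δ) (ω : Ω) : 0 ≤ u :=
  (abs_nonneg _).trans (h.bounded 0 ω)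

/-- [folklore] the partial sums `∑_{i<m} ρᵢδᵢ` are bounded by `m u`. -/
private theorem abs_sum_le (h : SRErrorModel μ u δ) {ρ : ℕ → ℤ} (hρ : ∀ i, ρ i = 1 ∨ ρ i = -1)
    (m : ℕ) (ω : Ω) : |∑ i ∈ range m, (ρ i : ℝ) * δ i ω| ≤ m * u := by
  refine (abs_sum_le_sum_abs _ _).trans ?_
  calc ∑ i ∈ range m, |(ρ i : ℝ) * δ i ω| ≤ ∑ _i ∈ range m, u :=
        sum_le_sum (fun i _ => abs_rho_mul_le h hρ i ω)
    _ = m * u := by rw [sum_const, card_range, nsmul_eq_mul]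

/-- [folklore] measurability of `exp(t ∑_{i<m} ρᵢδᵢ)`. -/
private theorem measurable_exp_sum (h : SRErrorModel μ u δ) (ρ : ℕ → ℤ) (m : ℕ) (t : ℝ) :
    Measurable (fun ω => exp (t * ∑ i ∈ range m, (ρ i : ℝ) * δ i ω)) :=
  (measurable_const.mul (Finset.measurable_sum _
    (fun i _ => measurable_const.mul (h.measurable i)))).exp

/-- [folklore] the bound `exp(t ∑_{i<m} ρᵢδᵢ) ≤ exp(|t| m u)`. -/
private theorem exp_sum_le (h : SRErrorModel μ u δ) {ρ : ℕ → ℤ} (hρ : ∀ i, ρ i = 1 ∨ ρ i = -1)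
    (m : ℕ) (t : ℝ) (ω : Ω) : exp (t * ∑ i ∈ range m, (ρ i : ℝ) * δ i ω) ≤ exp (|t| * (m * u)) := by
  refine Real.exp_le_exp.mpr ((le_abs_self _).trans ?_)
  rw [abs_mul]
  exact mul_le_mul_of_nonneg_left (abs_sum_le h hρ m ω) (abs_nonneg t)

/-- [folklore] integrability of `exp(t ∑_{i<m} ρᵢδᵢ)` on a probability space. -/
private theorem integrable_exp_sum [IsProbabilityMeasure μ] (h : SRErrorModel μ u δ) {ρ : ℕ → ℤ}
    (hρ : ∀ i, ρ i = 1 ∨ ρ i = -1) (m : ℕ) (t : ℝ) :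
    Integrable (fun ω => exp (t * ∑ i ∈ range m, (ρ i : ℝ) * δ i ω)) μ :=
  Integrable.of_mem_Icc 0 (exp (|t| * (m * u))) (measurable_exp_sum h ρ m t).aemeasurable
    (ae_of_all _ (fun ω => ⟨(exp_pos _).le, exp_sum_le h hρ m t ω⟩))

/-- [folklore] **mean independence applied to the exponential functional**:
`E[exp(t ∑_{i<m} ρᵢδᵢ) · δₘ] = 0`. -/
private theorem integral_exp_sum_mul_eq_zero [IsProbabilityMeasure μ] (h : SRErrorModel μ u δ)
    {ρ : ℕ → ℤ} (hρ : ∀ i, ρ i = 1 ∨ ρ i = -1) (m : ℕ) (t : ℝ) :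
    ∫ ω, exp (t * ∑ i ∈ range m, (ρ i : ℝ) * δ i ω) * δ m ω ∂μ = 0 := by
  set g : (Fin m → ℝ) → ℝ := fun v => exp (t * ∑ i : Fin m, (ρ i : ℝ) * clip u (v i)) with hg
  have hgm : Measurable g :=
    (measurable_const.mul (Finset.measurable_sum _ (fun i _ =>
      measurable_const.mul ((measurable_clip u).comp (measurable_pi_apply i))))).exp
  have hgb : ∃ C, ∀ v, |g v| ≤ C := by
    rcases isEmpty_or_nonempty Ω with hΩ | ⟨⟨ω₀⟩⟩
    · -- degenerate: any bound works since the conclusion is about `Fin m → ℝ`; use boundedness via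
      -- `|clip| ≤ |u|`-free argument: bound by `exp (|t| * (m * |u|))`
      refine ⟨exp (|t| * (m * |u|)), fun v => ?_⟩
      rw [hg]; dsimp only
      rw [abs_of_pos (exp_pos _)]
      refine Real.exp_le_exp.mpr ((le_abs_self _).trans ?_)
      rw [abs_mul]
      refine mul_le_mul_of_nonneg_left ?_ (abs_nonneg t)
      refine (abs_sum_le_sum_abs _ _).trans ?_
      calc ∑ i : Fin m, |(ρ i : ℝ) * clip u (v i)| ≤ ∑ _i : Fin m, |u| := by
            refine sum_le_sum (fun i _ => ?_)
            have habsρ : |(ρ i : ℝ)| = 1 := by rcases hρ i with h | h <;> simp [h]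
            rw [abs_mul, habsρ, one_mul]
            unfold clip
            rcases le_or_gt 0 u with hu | hu
            · rw [abs_of_nonneg hu, abs_le]
              exact ⟨le_max_left _ _, max_le (by linarith) (min_le_right _ _)⟩
            · have : max (-u) (min (v i) u) = -u := max_eq_left (by linarith [min_le_right (v i) u])
              rw [this, abs_of_neg hu, abs_neg, abs_of_neg hu]
        _ = m * |u| := by rw [sum_const, Finset.card_univ, Fintype.card_fin, nsmul_eq_mul]
    · have hu := u_nonneg h ω₀
      refine ⟨exp (|t| * (m * u)), fun v => ?_⟩
      rw [hg]; dsimp only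
      rw [abs_of_pos (exp_pos _)]
      refine Real.exp_le_exp.mpr ((le_abs_self _).trans ?_)
      rw [abs_mul]
      refine mul_le_mul_of_nonneg_left ?_ (abs_nonneg t)
      refine (abs_sum_le_sum_abs _ _).trans ?_
      calc ∑ i : Fin m, |(ρ i : ℝ) * clip u (v i)| ≤ ∑ _i : Fin m, u := by
            refine sum_le_sum (fun i _ => ?_)
            have habsρ : |(ρ i : ℝ)| = 1 := by rcases hρ i with h | h <;> simp [h]
            rw [abs_mul, habsρ, one_mul]; exact abs_clip_le hu _
        _ = m * u := by rw [sum_const, Finset.card_univ, Fintype.card_fin, nsmul_eq_mul]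
  have key := h.meanIndep m g hgm hgb
  have hgδ : ∀ ω, g (fun i => δ i ω) = exp (t * ∑ i ∈ range m, (ρ i : ℝ) * δ i ω) := by
    intro ω
    rw [hg]; dsimp only
    congr 2
    rw [Finset.sum_range (fun i => (ρ i : ℝ) * δ i ω)]
    exact Finset.sum_congr rfl (fun i _ => by rw [clip_eq_self (h.bounded i ω)])
  simp_rw [hgδ] at key
  exact key

/-- [folklore] **the mgf recursion (Azuma step)**: `E exp(t ∑_{i<m} ρᵢδᵢ) ≤ exp(m u² t²/2)`. -/
private theorem mgf_sum_le [IsProbabilityMeasure μ] (h : SRErrorModel μ u δ) (hu : 0 < u)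
    {ρ : ℕ → ℤ} (hρ : ∀ i, ρ i = 1 ∨ ρ i = -1) :
    ∀ m : ℕ, ∀ t : ℝ,
      ∫ ω, exp (t * ∑ i ∈ range m, (ρ i : ℝ) * δ i ω) ∂μ ≤ exp (m * u ^ 2 * t ^ 2 / 2) := by
  intro m
  induction m with
  | zero => intro t; simp
  | succ m ih =>
    intro t
    have iE := integrable_exp_sum h hρ m t
    have iEd : Integrable (fun ω => exp (t * ∑ i ∈ range m, (ρ i : ℝ) * δ i ω) * δ m ω) μ := by
      refine iE.mul_bdd (c := u) (h.measurable m).aestronglyMeasurable (ae_of_all _ (fun ω => ?_))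
      rw [Real.norm_eq_abs]; exact h.bounded m ω
    have hsplit : ∀ ω, exp (t * ∑ i ∈ range (m + 1), (ρ i : ℝ) * δ i ω)
        = exp (t * ∑ i ∈ range m, (ρ i : ℝ) * δ i ω) * exp (t * ((ρ m : ℝ) * δ m ω)) := by
      intro ω; rw [sum_range_succ, mul_add, exp_add]
    simp_rw [hsplit]
    have iL : Integrable (fun ω => exp (t * ∑ i ∈ range m, (ρ i : ℝ) * δ i ω)
        * exp (t * ((ρ m : ℝ) * δ m ω))) μ := by
      refine iE.mul_bdd (c := exp (|t| * u)) ?_ (ae_of_all _ (fun ω => ?_))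
      · exact ((measurable_const.mul (measurable_const.mul (h.measurable m))).exp).aestronglyMeasurable
      · rw [Real.norm_eq_abs, abs_of_pos (exp_pos _)]
        refine Real.exp_le_exp.mpr ((le_abs_self _).trans ?_)
        rw [abs_mul]
        exact mul_le_mul_of_nonneg_left (abs_rho_mul_le h hρ m ω) (abs_nonneg t)
    have hpt : ∀ ω, exp (t * ∑ i ∈ range m, (ρ i : ℝ) * δ i ω) * exp (t * ((ρ m : ℝ) * δ m ω))
        ≤ cosh (t * u) * exp (t * ∑ i ∈ range m, (ρ i : ℝ) * δ i ω)
          + sinh (t * u) / u * ((ρ m : ℝ) * (exp (t * ∑ i ∈ range m, (ρ i : ℝ) * δ i ω) * δ m ω)) := by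
      intro ω
      calc exp (t * ∑ i ∈ range m, (ρ i : ℝ) * δ i ω) * exp (t * ((ρ m : ℝ) * δ m ω))
          ≤ exp (t * ∑ i ∈ range m, (ρ i : ℝ) * δ i ω)
              * (cosh (t * u) + sinh (t * u) / u * ((ρ m : ℝ) * δ m ω)) :=
            mul_le_mul_of_nonneg_left (exp_mul_le_cosh_add hu (abs_rho_mul_le h hρ m ω) t)
              (exp_pos _).le
        _ = _ := by ring
    have iR : Integrable (fun ω => cosh (t * u) * exp (t * ∑ i ∈ range m, (ρ i : ℝ) * δ i ω)
          + sinh (t * u) / u * ((ρ m : ℝ) * (exp (t * ∑ i ∈ range m, (ρ i : ℝ) * δ i ω) * δ m ω))) μ :=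
      (iE.const_mul _).add ((iEd.const_mul _).const_mul _)
    calc ∫ ω, exp (t * ∑ i ∈ range m, (ρ i : ℝ) * δ i ω) * exp (t * ((ρ m : ℝ) * δ m ω)) ∂μ
        ≤ ∫ ω, (cosh (t * u) * exp (t * ∑ i ∈ range m, (ρ i : ℝ) * δ i ω)
          + sinh (t * u) / u * ((ρ m : ℝ) * (exp (t * ∑ i ∈ range m, (ρ i : ℝ) * δ i ω) * δ m ω))) ∂μ :=
          integral_mono iL iR hpt
      _ = cosh (t * u) * ∫ ω, exp (t * ∑ i ∈ range m, (ρ i : ℝ) * δ i ω) ∂μ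
          + sinh (t * u) / u * ((ρ m : ℝ)
            * ∫ ω, exp (t * ∑ i ∈ range m, (ρ i : ℝ) * δ i ω) * δ m ω ∂μ) := by
          rw [integral_add (iE.const_mul _) ((iEd.const_mul _).const_mul _), integral_const_mul,
            integral_const_mul, integral_const_mul]
      _ = cosh (t * u) * ∫ ω, exp (t * ∑ i ∈ range m, (ρ i : ℝ) * δ i ω) ∂μ := by
          rw [integral_exp_sum_mul_eq_zero h hρ m t, mul_zero, mul_zero, add_zero]
      _ ≤ cosh (t * u) * exp (m * u ^ 2 * t ^ 2 / 2) :=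
          mul_le_mul_of_nonneg_left (ih t) (cosh_pos _).le
      _ ≤ exp ((t * u) ^ 2 / 2) * exp (m * u ^ 2 * t ^ 2 / 2) :=
          mul_le_mul_of_nonneg_right (cosh_le_exp_half_sq _) (exp_pos _).le
      _ = exp (((m + 1 : ℕ) : ℝ) * u ^ 2 * t ^ 2 / 2) := by
          rw [← exp_add]; push_cast; ring_nf

/-- [folklore] sub-Gaussianity of `∑_{i<n} ρᵢδᵢ` with parameter `n u²`. -/
private theorem hasSubgaussianMGF_sum [IsProbabilityMeasure μ] (h : SRErrorModel μ u δ) (hu : 0 < u)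
    {ρ : ℕ → ℤ} (hρ : ∀ i, ρ i = 1 ∨ ρ i = -1) (n : ℕ) :
    HasSubgaussianMGF (fun ω => ∑ i ∈ range n, (ρ i : ℝ) * δ i ω)
      (((n : ℝ) * u ^ 2).toNNReal) μ where
  integrable_exp_mul t := integrable_exp_sum h hρ n t
  mgf_le t := by
    unfold mgf
    rw [Real.coe_toNNReal _ (by positivity)]
    exact mgf_sum_le h hu hρ n t

/-- [folklore] one tail in `ℝ≥0∞` form. -/
private theorem tail_le [IsProbabilityMeasure μ] {X : Ω → ℝ} {n : ℕ} (hn : 0 < n) (hu : 0 < u)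
    {lam : ℝ} (hlam : 0 < lam) (hX : HasSubgaussianMGF X (((n : ℝ) * u ^ 2).toNNReal) μ) :
    μ {ω | lam * Real.sqrt n * u ≤ X ω} ≤ ENNReal.ofReal (exp (-lam ^ 2 / 2)) := by
  have ha : 0 ≤ lam * Real.sqrt n * u := by positivity
  have h1 := hX.measure_ge_le ha
  have hn' : (0 : ℝ) < n := by exact_mod_cast hn
  have h2 : -(lam * Real.sqrt n * u) ^ 2 / (2 * ((((n : ℝ) * u ^ 2).toNNReal : ℝ≥0) : ℝ))
      = -lam ^ 2 / 2 := by
    rw [Real.coe_toNNReal _ (by positivity), mul_pow, mul_pow, Real.sq_sqrt hn'.le]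
    field_simp
  rw [h2] at h1
  calc μ {ω | lam * Real.sqrt n * u ≤ X ω}
      = ENNReal.ofReal (μ.real {ω | lam * Real.sqrt n * u ≤ X ω}) := (ofReal_measureReal).symm
    _ ≤ ENNReal.ofReal (exp (-lam ^ 2 / 2)) := ENNReal.ofReal_le_ofReal h1

/-! ### The discharge -/

/-- **CHM21 Theorem 4.6 holds in the SR error model** (discharge of the named fact `productBoundCHM`):
for `0 < u < 1`, `ρᵢ = ±1`, `λ > 0`,
`P(|∏_{i<n}(1 + δᵢ)^{ρᵢ} − 1| > γ̃ₙ(λ)) ≤ 2 exp(−λ²/2)`. Proof: linearisation `|log(1+δ) − δ| ≤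
u²/(1−u)` and `|e^L − 1| ≤ e^{|L|} − 1` reduce the event to `|∑ ρᵢδᵢ| ≥ λ√n u`; the sum has
sub-Gaussian mgf with parameter `n u²` by the elementary Azuma step (chord inequality + mean
independence), and Chernoff bounds each tail by `exp(−λ²/2)`.
[cite: ConnollyHighamMary2021, Thm. 4.6] -/
theorem productBoundCHM_holds : productBoundCHM := by
  intro Ω _ μ _ u δ hu hu1 h n ρ hρ lam hlam
  classical
  rcases Nat.eq_zero_or_pos n with hn | hn
  · subst hn
    have : {ω : Ω | gammaTilde 0 u lam < |(∏ i ∈ range 0, (1 + δ i ω) ^ (ρ i)) - 1|} = ∅ := by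
      ext ω; simp [gammaTilde]
    rw [this, measure_empty]; exact bot_le
  · set S : Ω → ℝ := fun ω => ∑ i ∈ range n, (ρ i : ℝ) * δ i ω with hS
    have hc : HasSubgaussianMGF S (((n : ℝ) * u ^ 2).toNNReal) μ := hasSubgaussianMGF_sum h hu hρ n
    have hincl : {ω : Ω | gammaTilde n u lam < |(∏ i ∈ range n, (1 + δ i ω) ^ (ρ i)) - 1|}
        ⊆ {ω | lam * Real.sqrt n * u ≤ S ω} ∪ {ω | lam * Real.sqrt n * u ≤ (-S) ω} := by
      intro ω hω
      simp only [Set.mem_union, Set.mem_setOf_eq, Pi.neg_apply] at hω ⊢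
      by_contra hcon
      rw [not_or, not_le, not_le] at hcon
      have hSa : |S ω| < lam * Real.sqrt n * u := abs_lt.mpr ⟨by linarith [hcon.2], hcon.1⟩
      have := prod_sub_one_lt_gammaTilde hu1 (fun i => h.bounded i ω) hρ hSa
      exact lt_irrefl _ (this.trans hω)
    calc μ {ω : Ω | gammaTilde n u lam < |(∏ i ∈ range n, (1 + δ i ω) ^ (ρ i)) - 1|}
        ≤ μ ({ω | lam * Real.sqrt n * u ≤ S ω} ∪ {ω | lam * Real.sqrt n * u ≤ (-S) ω}) :=
          measure_mono hincl
      _ ≤ μ {ω | lam * Real.sqrt n * u ≤ S ω} + μ {ω | lam * Real.sqrt n * u ≤ (-S) ω} :=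
          measure_union_le _ _
      _ ≤ ENNReal.ofReal (exp (-lam ^ 2 / 2)) + ENNReal.ofReal (exp (-lam ^ 2 / 2)) :=
          add_le_add (tail_le hn hu hlam hc) (tail_le hn hu hlam hc.neg)
      _ = ENNReal.ofReal (2 * exp (-lam ^ 2 / 2)) := by
          rw [← ENNReal.ofReal_add (exp_pos _).le (exp_pos _).le, two_mul]

end Literature.ComputerArithmetic.ConnollyHighamMary2021
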